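import Summits.QuantumFields.YangMills.Theorems.F4SubCurvatureDoorTransverseSliceGeometry
import Summits.QuantumFields.YangMills.Theorems.F4SubCurvatureDoorGaussCosinePositivity
import Mathlib
import HarnessLib

/-!
# Route `F4SubCurvatureDoor`, crux ⟨stmt-QuantumFields-23035⟩ `ShortRootRigidity`: LINE g19-A «transverse slice» (planner ym-idea-3 g19, tree
# skeleton `Cruxes/ShortRootRigidity/Lines/transverse_slice.lean`) — registered stub (1) `stub_sliceInClass` BY NAME AND SIGNATURE

The name-keyed statements of the skeleton (`hexReflection`, `InPlanarClass`, `SliceInClass`) copied VERBATIM into this file's own namespace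
(`E2`, `planeEmb`, `perpEmb`, `weight`, `slice`, also verbatim, are those of ✓`F4SubCurvatureDoorSliceDensityRegistered`; pattern of
✓`F4SubCurvatureDoorNullConePointednessRegistered`), and the registered stub `theorem stub_sliceInClass : SliceInClass` — every transverse
slice `y ↦ ∫ K(ι y + ι^⊥ x) cos⟪a,x⟫ e^{−‖x‖²/2} dx` of a kernel of the C3 class lies in the planar class — assembled from

* ✓`F4SubCurvatureDoorTransverseSliceGeometry` (conjuncts 1, 2, 3, 4, 5, 7: continuity off `0` and boundedness by dominated convergence,
  `θ₂`- and hexagonal invariance and evenness from `W(B₄) ∋ θ₄, −1` and the `D₄`-preserving diagonal reflection, the planar budget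
  `‖y‖⁶·slice → 0` from `‖z‖⁸K → 0`), and
* conjunct 6 ★ `slice_reflectionPositive` (this file): REFLECTION POSITIVITY INSIDE THE PLANE.  For `yᵢ` with `(yᵢ)₀ > 0` and real `cᵢ`,
  `Σ cᵢcⱼ · slice K a (θ₂yᵢ − yⱼ) = ∫ S(x) cos⟪a,x⟫ e^{−‖x‖²/2} dx` with `S(x) = Σ cᵢcⱼ K(ι(θ₂yᵢ − yⱼ) + ι^⊥x)`; four-dimensional
  reflection positivity on the finite families `{ι yᵢ + ι^⊥ u_k}` (`θ₄` fixes `ι^⊥u`) makes `S` a continuous, even, real positive-definite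
  function on `ℝ²` (`rp_fintype`, `timeReflection_planeEmb_sub`), whose Gaussian–cosine moments are nonnegative by
  ✓`F4SubCurvatureDoorSliceFourier.integral_mul_cosGauss_nonneg_of_realPosDef` (Bochner-type Fourier positivity, tree `BochnerProofs`).

Mathlib + tree only; no `sorry`; standard axioms.  HONEST FRAMING: support stub (1) (M–L, routine) of a freshly filed line; the heart
`stub_planarRigidity` (XL, priced P1 by idea-crit-4), stub (4) `stub_oddModeRigidity`, crux 23035 / 23125, rung R2d (`BalabanLadder.ROT`) and
every summit statement are untouched; the Yang–Mills mass gap is NOT proved.  Width seat `ym-line-sfw-p2-w3` g36 (cell ym-idea-1, free hands).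
-/

set_option autoImplicit false

noncomputable section

namespace Summit.QuantumFields.YangMills.Theorems.F4SubCurvatureDoorSliceInClassRegistered

open scoped Topology BigOperators RealInnerProductSpace
open Filter Set MeasureTheory
open Literature.MathematicalPhysics.QuantumLattice (timeReflection timeReflection_apply siteToE)
open Summit.QuantumFields.YangMills.Cruxes.OSLegsAtWeakCouplingC.Sketch (IsSignedPerm)
open Summit.QuantumFields.YangMills.Theorems.F4SubCurvatureDoorMirrorAnalyticityRegistered (E4 InClass)
open Summit.QuantumFields.YangMills.Theorems.F4SubCurvatureDoorGlobalReduction (isSignedPerm_neg)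
open Summit.QuantumFields.YangMills.Theorems.F4SubCurvatureDoorSliceDensityRegistered
  (E2 planeEmb perpEmb weight slice planeEmb_add_perpEmb_apply_zero perpEmb_neg continuous_comp_slice exists_bound_comp_slice)
open Summit.QuantumFields.YangMills.Theorems.F4SubCurvatureDoorSliceInClass
  (timeReflection_planeEmb_sub isSignedPerm_timeReflection slice_timeReflection slice_hexReflection slice_neg continuousOn_slice
   exists_bound_slice tendsto_norm_pow_six_mul_slice)
open Summit.QuantumFields.YangMills.Theorems.F4SubCurvatureDoorSliceFourier (integral_mul_cosGauss_nonneg_of_realPosDef integrable_mul_gauss)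
open Summit.QuantumFields.YangMills.Theorems.F4SubCurvatureDoorLowDegreeChannels (exists_diag_reflection)

/-! ## The name-keyed statements (verbatim from the skeleton) -/

/-- The hexagonal reflection of the plane: reflection in the line orthogonal to `n' = (½, √3/2)` (the image of `σ_{n₂}` under `ι`)
(verbatim from the skeleton). [problem-side definition] -/
def hexReflection (y : E2) : E2 :=
  (WithLp.equiv 2 (Fin 2 → ℝ)).symm ![y 0 / 2 - Real.sqrt 3 / 2 * y 1, -(Real.sqrt 3 / 2 * y 0) - y 1 / 2]

/-- THE PLANAR CLASS: `k : ℝ² → ℝ` continuous off `0`, bounded outside the unit disc, invariant under the hexagonal group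
`D₆ = ⟨θ₂, σ_{n'}, −1⟩`, reflection positive across `y₀ = 0` inside the plane, with the 2D sub-curvature budget `‖y‖⁶ k → 0`
(verbatim from the skeleton). [problem-side definition] -/
def InPlanarClass (k : E2 → ℝ) : Prop :=
  ContinuousOn k {y | y ≠ 0} ∧
  (∃ C : ℝ, ∀ y, 1 ≤ ‖y‖ → |k y| ≤ C) ∧
  (∀ y, k (timeReflection 2 y) = k y) ∧
  (∀ y, k (hexReflection y) = k y) ∧
  (∀ y, k (-y) = k y) ∧
  (∀ (m : ℕ) (y : Fin m → E2) (c : Fin m → ℝ), (∀ i, 0 < y i 0) →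
      0 ≤ ∑ i, ∑ j, c i * c j * k (timeReflection 2 (y i) - y j)) ∧
  Tendsto (fun y : E2 => ‖y‖ ^ 6 * k y) (𝓝[≠] 0) (𝓝 0)

/-- Obligation (1) «SLICES ARE PLANAR KERNELS»: every transverse slice of a kernel of the C3 class lies in the planar class
(verbatim from the skeleton). [problem-side definition] -/
def SliceInClass : Prop :=
  ∀ K : E4 → ℝ, InClass K → ∀ a : E2, InPlanarClass (slice K a)

/-! ## Conjunct 6: reflection positivity inside the plane -/

variable {K : E4 → ℝ}

/-- Four-dimensional reflection positivity for families indexed by an arbitrary finite type (reindexing through `Fintype.equivFin`). -/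
theorem rp_fintype
    (hRP : ∀ (m : ℕ) (x : Fin m → E4) (c : Fin m → ℝ), (∀ i, 0 < x i 0) →
      0 ≤ ∑ i, ∑ j, c i * c j * K (timeReflection 4 (x i) - x j))
    {ι : Type*} [Fintype ι] (X : ι → E4) (C : ι → ℝ) (hX : ∀ p, 0 < X p 0) :
    0 ≤ ∑ p, ∑ q, C p * C q * K (timeReflection 4 (X p) - X q) := by
  classical
  set e := Fintype.equivFin ι
  have h := hRP (Fintype.card ι) (fun i => X (e.symm i)) (fun i => C (e.symm i)) (fun i => hX _)
  have h1 : ∑ i, ∑ j, C (e.symm i) * C (e.symm j) * K (timeReflection 4 (X (e.symm i)) - X (e.symm j)) =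
      ∑ p, ∑ q, C p * C q * K (timeReflection 4 (X p) - X q) := by
    rw [e.symm.sum_comp (fun p => ∑ j, C p * C (e.symm j) * K (timeReflection 4 (X p) - X (e.symm j)))]
    exact Finset.sum_congr rfl fun p _ => e.symm.sum_comp (fun q => C p * C q * K (timeReflection 4 (X p) - X q))
  rw [h1] at h
  exact h

/-- Frame identity for the evenness of the symmetrised kernel: `−θ₄(ι(θ₂y − y') − ι^⊥x) = ι(θ₂y' − y) + ι^⊥x`. -/
theorem neg_timeReflection_frame (y y' x : E2) :
    -(timeReflection 4 (planeEmb (timeReflection 2 y - y') + perpEmb (-x))) = planeEmb (timeReflection 2 y' - y) + perpEmb x := by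
  ext i
  simp only [planeEmb, perpEmb, WithLp.equiv_symm_apply, PiLp.add_apply, PiLp.sub_apply, PiLp.neg_apply, timeReflection_apply]
  fin_cases i <;> simp <;> ring

/-- For `y₀, y'₀ > 0` the difference `θ₂y − y'` has negative time coordinate, so it is not `0`. -/
theorem timeReflection_sub_ne_zero {y y' : E2} (hy : 0 < y 0) (hy' : 0 < y' 0) : timeReflection 2 y - y' ≠ 0 := by
  intro h
  have := congrArg (fun v : E2 => v 0) h
  simp [timeReflection_apply] at this
  linarith

/-- ★ **Conjunct 6 — reflection positivity inside the plane.**  For a kernel `K` continuous off `0`, bounded outside the unit ball,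
`W(B₄)`-invariant and reflection positive across `x₀ = 0`, every transverse slice is reflection positive across `y₀ = 0`:
`Σᵢⱼ cᵢcⱼ slice K a (θ₂yᵢ − yⱼ) = ∫ S(x) cos⟪a,x⟫e^{−‖x‖²/2} dx ≥ 0`, where `S(x) = Σ cᵢcⱼ K(ι(θ₂yᵢ − yⱼ) + ι^⊥x)` is continuous, even and
positive definite on `ℝ²` (four-dimensional RP on the families `{ι yᵢ + ι^⊥u_k}`; `θ₄` fixes `ι^⊥u`). -/
theorem slice_reflectionPositive (hK : ContinuousOn K {x | x ≠ 0}) (hb : ∃ C : ℝ, ∀ x, 1 ≤ ‖x‖ → |K x| ≤ C)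
    (hB4 : ∀ R : E4 ≃ₗᵢ[ℝ] E4, IsSignedPerm R → ∀ x, K (R x) = K x)
    (hRP : ∀ (m : ℕ) (x : Fin m → E4) (c : Fin m → ℝ), (∀ i, 0 < x i 0) →
      0 ≤ ∑ i, ∑ j, c i * c j * K (timeReflection 4 (x i) - x j))
    (a : E2) (m : ℕ) (y : Fin m → E2) (c : Fin m → ℝ) (hy : ∀ i, 0 < y i 0) :
    0 ≤ ∑ i, ∑ j, c i * c j * slice K a (timeReflection 2 (y i) - y j) := by
  have hne : ∀ i j, timeReflection 2 (y i) - y j ≠ 0 := fun i j => timeReflection_sub_ne_zero (hy i) (hy j)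
  have heven : ∀ v : E4, K (-v) = K v := fun v => by simpa using hB4 (LinearIsometryEquiv.neg ℝ) isSignedPerm_neg v
  -- the symmetrised kernel on the transverse plane
  obtain ⟨S, hS⟩ : ∃ S : E2 → ℝ, ∀ x, S x = ∑ i, ∑ j, c i * c j * K (planeEmb (timeReflection 2 (y i) - y j) + perpEmb x) :=
    ⟨_, fun _ => rfl⟩
  have hSc : Continuous S := by
    have : S = fun x => ∑ i, ∑ j, c i * c j * K (planeEmb (timeReflection 2 (y i) - y j) + perpEmb x) := funext hS
    rw [this]
    exact continuous_finsetSum _ fun i _ => continuous_finsetSum _ fun j _ =>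
      continuous_const.mul (continuous_comp_slice hK (hne i j))
  have hSeven : ∀ x, S (-x) = S x := by
    intro x
    rw [hS, hS]
    have hij : ∀ i j, K (planeEmb (timeReflection 2 (y i) - y j) + perpEmb (-x)) =
        K (planeEmb (timeReflection 2 (y j) - y i) + perpEmb x) := by
      intro i j
      rw [← neg_timeReflection_frame (y i) (y j) x, heven, hB4 _ isSignedPerm_timeReflection]
    simp_rw [hij]
    rw [Finset.sum_comm]
    exact Finset.sum_congr rfl fun j _ => Finset.sum_congr rfl fun i _ => by ring
  have hSPD : ∀ (n : ℕ) (u : Fin n → E2) (d : Fin n → ℝ), 0 ≤ ∑ k, ∑ l, d k * d l * S (u k - u l) := by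
    intro n u d
    have h := rp_fintype hRP (ι := Fin m × Fin n) (fun p => planeEmb (y p.1) + perpEmb (u p.2)) (fun p => c p.1 * d p.2)
      (fun p => by rw [planeEmb_add_perpEmb_apply_zero]; exact hy p.1)
    simp only [Fintype.sum_prod_type, timeReflection_planeEmb_sub] at h
    have lhs : ∑ k, ∑ l, d k * d l * S (u k - u l) =
        ∑ k, ∑ l, ∑ i, ∑ j, d k * d l * (c i * c j * K (planeEmb (timeReflection 2 (y i) - y j) + perpEmb (u k - u l))) := by
      simp only [hS, Finset.mul_sum]
    rw [lhs]
    calc (0 : ℝ) ≤ ∑ i, ∑ k, ∑ j, ∑ l,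
          c i * d k * (c j * d l) * K (planeEmb (timeReflection 2 (y i) - y j) + perpEmb (u k - u l)) := h
      _ = ∑ k, ∑ i, ∑ j, ∑ l,
          c i * d k * (c j * d l) * K (planeEmb (timeReflection 2 (y i) - y j) + perpEmb (u k - u l)) := Finset.sum_comm
      _ = ∑ k, ∑ i, ∑ l, ∑ j,
          c i * d k * (c j * d l) * K (planeEmb (timeReflection 2 (y i) - y j) + perpEmb (u k - u l)) :=
          Finset.sum_congr rfl fun k _ => Finset.sum_congr rfl fun i _ => Finset.sum_comm
      _ = ∑ k, ∑ l, ∑ i, ∑ j,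
          c i * d k * (c j * d l) * K (planeEmb (timeReflection 2 (y i) - y j) + perpEmb (u k - u l)) :=
          Finset.sum_congr rfl fun k _ => Finset.sum_comm
      _ = ∑ k, ∑ l, ∑ i, ∑ j, d k * d l * (c i * c j * K (planeEmb (timeReflection 2 (y i) - y j) + perpEmb (u k - u l))) :=
          Finset.sum_congr rfl fun k _ => Finset.sum_congr rfl fun l _ => Finset.sum_congr rfl fun i _ =>
            Finset.sum_congr rfl fun j _ => by ring
  -- positivity of the Gaussian–cosine moment of `S`
  have hpos := integral_mul_cosGauss_nonneg_of_realPosDef S hSc hSPD hSeven a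
  -- the double sum of slices is that moment
  have hint : ∀ i j, Integrable (fun x : E2 => K (planeEmb (timeReflection 2 (y i) - y j) + perpEmb x) * weight a x) := by
    intro i j
    obtain ⟨C, hC⟩ := exists_bound_comp_slice hK hb (hne i j)
    have hf : Continuous fun x : E2 => K (planeEmb (timeReflection 2 (y i) - y j) + perpEmb x) * Real.cos ⟪a, x⟫ :=
      (continuous_comp_slice hK (hne i j)).mul (Real.continuous_cos.comp (continuous_const.inner continuous_id))
    have := integrable_mul_gauss hf (C := C * 1) (fun x => by
      rw [abs_mul]; exact mul_le_mul (hC x) (Real.abs_cos_le_one _) (abs_nonneg _) ((abs_nonneg _).trans (hC x)))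
    refine this.congr (ae_of_all _ fun x => ?_)
    simp only [weight]
    ring
  have key : ∑ i, ∑ j, c i * c j * slice K a (timeReflection 2 (y i) - y j) =
      ∫ x, S x * (Real.cos ⟪a, x⟫ * Real.exp (-(‖x‖ ^ 2 / 2))) := by
    have h1 : ∀ i j, c i * c j * slice K a (timeReflection 2 (y i) - y j) =
        ∫ x, c i * c j * (K (planeEmb (timeReflection 2 (y i) - y j) + perpEmb x) * weight a x) := by
      intro i j
      rw [integral_const_mul]
      rfl
    simp_rw [h1]
    have h2 : ∀ i, ∑ j, ∫ x, c i * c j * (K (planeEmb (timeReflection 2 (y i) - y j) + perpEmb x) * weight a x) =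
        ∫ x, ∑ j, c i * c j * (K (planeEmb (timeReflection 2 (y i) - y j) + perpEmb x) * weight a x) := fun i =>
      (integral_finsetSum Finset.univ (fun j _ => (hint i j).const_mul (c i * c j))).symm
    simp_rw [h2]
    rw [← integral_finsetSum Finset.univ (fun i _ => integrable_finsetSum Finset.univ
      (fun j _ => (hint i j).const_mul (c i * c j)))]
    refine integral_congr_ae (ae_of_all _ fun x => ?_)
    beta_reduce
    rw [hS, Finset.sum_mul]
    refine Finset.sum_congr rfl fun i _ => ?_
    rw [Finset.sum_mul]
    refine Finset.sum_congr rfl fun j _ => ?_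
    simp only [weight]
    ring
  rw [key]
  exact hpos

/-! ## The registered stub -/

/-- **Registered stub (1) of LINE g19-A, BY NAME AND SIGNATURE**: `SliceInClass` holds — every Gaussian–cosine transverse slice of a
kernel of the C3 class is continuous off `0`, bounded outside the unit disc, `D₆`-invariant, reflection positive across `y₀ = 0` inside the
plane, and satisfies the planar sub-curvature budget `‖y‖⁶ · slice → 0`. [folklore] -/
theorem stub_sliceInClass : SliceInClass := by
  intro K hK a
  obtain ⟨hcont, hbdd, hB4, hRP, hbud, hlat⟩ := hK
  have heven : ∀ v : E4, K (-v) = K v := fun v => by simpa using hB4 (LinearIsometryEquiv.neg ℝ) isSignedPerm_neg v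
  obtain ⟨S, hS, hSlat⟩ := exists_diag_reflection
  refine ⟨continuousOn_slice hcont hbdd a, exists_bound_slice hbdd a, fun y => slice_timeReflection hB4 a y,
    fun y => slice_hexReflection S hS (hlat S hSlat) a y, fun y => slice_neg heven a y,
    fun m y c hy => slice_reflectionPositive hcont hbdd hB4 hRP a m y c hy, tendsto_norm_pow_six_mul_slice hcont hbdd hbud a⟩

end Summit.QuantumFields.YangMills.Theorems.F4SubCurvatureDoorSliceInClassRegistered

end
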